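import Summits.QuantumFields.YangMills.Theorems.BalabanUVNodesN19HybridBeyondTarget

/-!
# Sketch 2 — crux idea `window-key-core` (seat ym-nodeO-idea-3 g8, lens `complete`, crux K3⁷
`Summit.QuantumFields.YangMills.Theses.BalabanUVNodes.SpineGivenEndpointR13SepCoPH`, item stmt-QuantumFields-20544;
skeleton of record v5 941dddb108cbaacf, stub 2 `stub_expansion13H`, conjunct `KeyedCoreEdgeHolderD4` = N19′ `∃ δ, NE7.Core … ∧ Summable δ`).

HONESTY.  Nothing here proves or approaches the Yang–Mills mass gap (Clay); `route-QuantumFields-BalabanUVNodes.closes`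
concludes only the CONDITIONAL finite-𝕋⁴ rung `BalabanLadder.UV`; [B12] Thm 2 is unproved in print; nothing of Bałaban is
asserted or instantiated.  §1 is an elementary CARICATURE (a reading over `ℕ`-labelled classes) run through dag-n19-w1's
kernel guard `N19HybridBeyondTarget.not_coreEdge_of_unsummable_gap` [folklore]; §2 are STATEMENTS of two elementary real-series
lemmas (not proved here — planners do not prove); §3 are HYPOTHESIS SHAPES (physics letters, NOT in print, NOT facts).

THE LEVER (words).  `NE7.Core` asks ONE constant per `K`, uniform over ALL good classes.  At the record's pinned key
(`crOfRecord₁₃V`: σ-packed FULL large-field histories, [III] (2.18) before the 𝐑-operation) and at the cut value `jc K = 0`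
that first-level saturation forces (dag-n20-w1 `…N20KeyedRelWeightPolicyWall`, p597932), the good classes include the two
EXTREME keys «every level-1 block large-field» and «no large field», whose two-run vacuum log-ratios differ by
`n_K · D₀` — `n_K` = number of level-1 blocks `→ ∞`, `D₀` = the two runs' difference of the large-vs-small single-block free-energy
CONTRAST at the oldest level (≠ 0: the oldest terms do not forget the cutoff, NE5's `C₅θ⁰ = O(1)`).  §1: such a reading has NO
summable `Core`.  Bałaban's own bookkeeping never keys old SMALL regions: a region `Z` born at level `j` is pending only for the
`K(Z)` steps of [LF-II] (1.80) p.384 (until `S^{K}(Z)` meets (i),(ii) and 𝐑 applies), so at the WINDOW key the unbooked gap is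
`vol · Σ_{m ≤ j⋆(K)} L^{4m} · Cθ^{K−m}` (§2: summable iff the window is a small FRACTION of `K` — [III] p.244 ∕ [IV] p.175 made
quantitative) and the keys carrying an over-aged pending region are RARE ((1.80): the activity pays the cumulative entropy), so
N20's weight face books them summably instead of being «eventually zero».
-/

namespace YMNodeOIdeate.Idea3.WindowKeyCore

open Finset Filter
open Summit.QuantumFields.BalabanUV.T4Continuum.Spine.NE7 (Core)
open Summit.QuantumFields.YangMills.BalabanUVNodes.N19HybridBeyondTarget (not_coreEdge_of_unsummable_gap)

/-! ## §1 The extensive-gap caricature: classes labelled by the old-large-field count, log-ratio linear in the label -/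

/-- CARICATURE READING of the zero-dial N19′ slot at a FULL-HISTORY key: at level `K` the good classes are the old-large-field
counts `v ∈ {0, …, n K}` (no bad class), run A's core is normalised to `1` and run B's core is `exp (c K + D * v)` — a per-old-block
two-run vacuum increment `D` (the runs' difference of the large-vs-small single-block free-energy contrast at the oldest level)
on top of the class-independent constant `c K`.  (Independent-block product caricature of the record's `weightA₁₃ ∕ weightB₁₃`
fibre sums; nothing of Bałaban's is instantiated.) -/
noncomputable def caricatureQ (c : ℕ → ℝ) (D : ℝ) : ℕ → ℝ → ℕ → ℝ :=
  fun K _t v => Real.exp (c K + D * v)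

/-- **§1 THE KILL (kernel, via dag-n19-w1's guard)** [folklore]: if the per-old-block increment `D` is positive and every level has at
least one old block (`1 ≤ n K`; physically `n K = vol·L^{4(K₀+K−1)} → ∞`), the caricature reading admits NO `δ` with
`Core … δ ∧ Summable δ` — whatever the constants `c K`, whatever `vol`, at any source radius `l₀ ≥ 0`.  The gap between the extreme
good classes `v = n K` and `v = 0` is `D · n K ≥ D`, not summable; `not_coreEdge_of_unsummable_gap` concludes. -/
theorem caricature_not_coreEdge (l₀ vol : ℝ) (hl₀ : 0 ≤ l₀) (n : ℕ → ℕ) (hn : ∀ K, 1 ≤ n K) (c : ℕ → ℝ)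
    {D : ℝ} (hD : 0 < D) :
    ¬ ∃ δ : ℕ → ℝ, Core l₀ vol (fun K => range (n K + 1)) (fun _ _ => (∅ : Finset ℕ)) (fun _ _ _ => (1 : ℝ))
        (caricatureQ c D) δ ∧ Summable δ := by
  refine not_coreEdge_of_unsummable_gap (g := fun K => D * (n K : ℝ)) (fun K => by positivity) ?_ ?_
  · -- `D · n K ≥ D > 0` does not tend to zero, hence is not summable
    intro hs
    have h0 := hs.tendsto_atTop_zero
    have hev : ∀ᶠ K in atTop, D * (n K : ℝ) < D := by
      have := h0.eventually (gt_mem_nhds hD)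
      exact this
    obtain ⟨K, hK⟩ := hev.exists
    have h1 : (1 : ℝ) ≤ (n K : ℝ) := by exact_mod_cast hn K
    nlinarith
  · intro K
    refine ⟨0, by simpa using hl₀, n K, by simp, 0, by simp, one_pos, one_pos, ?_⟩
    simp [caricatureQ, Real.log_exp]

/-! ## §2 The window budget (statements; elementary) -/

/-- The UNBOOKED two-run gap per unit volume at the WINDOW key: pending large-field blocks of age `m ≤ j⋆ K` number at most
`L^{4m}` per unit volume and each carries a two-run increment `≤ C·θ^{K−m}` (young terms forget the cutoff, hypothesis shape
`YoungGap` below) — total `C · θ^K · Σ_{m ≤ j⋆ K} (L⁴/θ)^m`.  The FULL-history key is the case `j⋆ K = K`. -/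
noncomputable def windowBudget (C L θ : ℝ) (jstar : ℕ → ℕ) (K : ℕ) : ℝ :=
  C * θ ^ K * ∑ m ∈ range (jstar K + 1), (L ^ 4 / θ) ^ m

/-- FRACTION CONDITION ([III] CMP 119 p.244 ∕ [IV] CMP 122 p.175 «restrictions only in several previous steps, their number is
a small fraction of the number K», made quantitative): eventually `j⋆(K) ≤ κ·K` with `(L⁴/θ)^κ · θ < 1`, i.e.
`κ < log θ⁻¹ ∕ log (L⁴θ⁻¹)`.  Bałaban's (1.80) window is `O(R_j + log_L(size))`, poly-logarithmic in `K` for bookable regions. -/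
def FractionCondition (L θ : ℝ) (jstar : ℕ → ℕ) : Prop :=
  ∃ κ : ℝ, 0 ≤ κ ∧ (L ^ 4 / θ) ^ κ * θ < 1 ∧ ∀ᶠ K : ℕ in atTop, (jstar K : ℝ) ≤ κ * K

/-- WINDOW LEMMA (statement; elementary geometric-series estimate): under the fraction condition the window budget is summable
(indeed exponentially small in `K`). -/
def WindowLemma : Prop :=
  ∀ (C L θ : ℝ) (jstar : ℕ → ℕ), 0 ≤ C → 1 < L → 0 < θ → θ < 1 → FractionCondition L θ jstar →
    Summable (windowBudget C L θ jstar)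

/-- FULL-KEY LEMMA (statement; elementary): with NO window (`j⋆ K = K`, the record's full-history key) the budget dominates
`C · L^{4K}` and is not summable for `C > 0` — the per-unit-volume form of §1's extensive gap. -/
def FullKeyLemma : Prop :=
  ∀ (C L θ : ℝ), 0 < C → 1 < L → 0 < θ → θ < 1 → ¬ Summable (windowBudget C L θ fun K => K)

/-! ## §3 Hypothesis shapes the line would discharge (physics letters; NOT in print; NOT facts) -/

/-- (YG) YOUNG GAP — the ONE physics letter of the window road: at the window key, the two-run log-ratio of the good classes'
cores is additive over pending large-field blocks up to a class-independent constant, with a per-block increment at age `m`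
bounded by `u m K`, `0 ≤ u m K ≤ C·θ^{K−m}` for `m ≤ j⋆ K` (young pending factors forget the cutoff like NE5's small-field terms;
the substance of [III] §2–3 + [IV]∕[V] 𝐑 for TWO runs — XL, ownerless).  Shape only: `gap K` majorises the class-oscillation of
the log-ratio per unit volume. -/
def YoungGap (C L θ : ℝ) (jstar : ℕ → ℕ) (gap : ℕ → ℝ) : Prop :=
  ∀ K, 0 ≤ gap K ∧ gap K ≤ windowBudget C L θ jstar K

/-- (AC) AGE-CUT WEIGHT — N20's face at the window key: the weight fraction `W K` of keys carrying a pending region OLDER than its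
own (1.80) window plus a `κ₁·log K` margin is summable ((1.80) p.384: `κ_j(Z)` pays the cumulative blow-up entropy
`Σ_n O(1) M^d R^d d′_n(S^{n−j} Z)`; the margin gives `K^{−c κ₁}`; regions born in the ultraviolet half pay `exp(−p₀(g_{K∕2}))`,
super-polynomially small).  Shape only. -/
def AgeCutWeight (W : ℕ → ℝ) : Prop :=
  (∀ K, 0 ≤ W K) ∧ Summable W

/-- WHAT THE WINDOW ROAD RETURNS to stub 2's N19′ ∧ N20 conjuncts (shape): a summable Core radius (small-field channel `δSF` from node
U6's geometric `T4CauchySum.delta` + the window budget) and a summable booked weight — at the WINDOW key, zero shells. -/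
def WindowRoadOutput (C L θ : ℝ) (jstar : ℕ → ℕ) (δSF W : ℕ → ℝ) : Prop :=
  Summable δSF ∧ Summable (windowBudget C L θ jstar) ∧ AgeCutWeight W

/-- Sanity (definitional): the road's Core radius `δSF + windowBudget` is summable when both halves are. -/
example (C L θ : ℝ) (jstar : ℕ → ℕ) (δSF W : ℕ → ℝ) (h : WindowRoadOutput C L θ jstar δSF W) :
    Summable (fun K => δSF K + windowBudget C L θ jstar K) := h.1.add h.2.1

end YMNodeOIdeate.Idea3.WindowKeyCore
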